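import Summits.MatrixMultiplication.OmegaCensus.BoxBadHeis5

/-!
# ω-census, family (b3): conjecture C9 on the HEISENBERG FAMILY — planar boxes of `Heis p`, heights, and the pattern lemma

HONEST FRAMING (pub-omega census; verbatim): lottery ticket; floor = certified bounds/negative ranges.
Census BOOKKEEPING (conjecture C9 of the cell; pub-omega stpp-1 gen 19).  For the kernel model `Heis p` of the Heisenberg group
mod `p` (`BoxBadHeis5`: `(a,b,c)(a',b',c') = (a+a', b+b', c+c'+ab')`, any `p`) this file reduces the independence of a cell set in
a `3 × 3` box to a finite PATTERN condition on `(Fin 3 × Fin 3) × ZMod p`: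
* a *planar box* `D` (`PlanarBox`) is the list of `(a,b)`-coordinates `(α i, β i)` of the three `Y`-elements and `(μ j, ν j)`
  of the three `W`-elements (central coordinates `0`; central parts only re-gauge heights, so nothing is lost);
* the *height* of a cell `(x, y_i, w_j)` is `x.c + corr` with an explicit quadratic correction `PlanarBox.corr`; the cell of
  column `c = (i, j)` over `(x₁, x₂)` at height `h` is `PlanarBox.cell`;
* KEY IDENTITY (`PlanarBox.cellWord_cell`): two such cells interact (`cellWord = 1`) only if their `(a,b)`-invariants agree
  AND their heights differ by the constant `PlanarBox.tau D c c' = det(u_i,u_{i'}) + det(v_j,v_{j'}) + (α_i − α_{i'})ν_{j'} +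
  (μ_j − μ_{j'})β_i` — the symplectic form of `Heis p` and nothing else;
* hence (`PlanarBox.not_boxUseful_of_pattern`) a pattern `T ⊆ (Fin 3 × Fin 3) × ZMod p` with no ordered pair at a forbidden
  height difference (`PatIndep`) lifts to an independent cell set of `#T · p²` cells (`cellSet`, `card_cellSet`), and
  `9p ≤ 5·#T` makes `Heis p` not box-useful; `exists_indep_of_pattern` is the witness form used for lifting along maps.
The uniform family (all odd `p ≥ 3`) is `HeisenbergUniform.lean`.  Nothing here is progress on `ω`.
-/

namespace Summit.MatrixMultiplication.OmegaCensus

open Finset ProductBoxBound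

namespace Heis

variable {p : ℕ}

/-- Planar box data for `Heis p`: `(α i, β i)` are the `(a,b)`-coordinates of the `Y`-element `y_i`, `(μ j, ν j)` those of the
`W`-element `w_j` (central coordinates are taken `0`). [folklore] -/
structure PlanarBox (p : ℕ) where
  /-- `a`-coordinates of `y₀, y₁, y₂` -/
  α : Fin 3 → ZMod p
  /-- `b`-coordinates of `y₀, y₁, y₂` -/
  β : Fin 3 → ZMod p
  /-- `a`-coordinates of `w₀, w₁, w₂` -/
  μ : Fin 3 → ZMod p
  /-- `b`-coordinates of `w₀, w₁, w₂` -/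
  ν : Fin 3 → ZMod p

namespace PlanarBox

variable (D : PlanarBox p)

/-- The `Y`-element `y_i = ⟨α i, β i, 0⟩`. [folklore] -/
def yEl (i : Fin 3) : Heis p := ⟨D.α i, D.β i, 0⟩

/-- The `W`-element `w_j = ⟨μ j, ν j, 0⟩`. [folklore] -/
def wEl (j : Fin 3) : Heis p := ⟨D.μ j, D.ν j, 0⟩

/-- The forbidden height difference from column `c = (i,j)` to column `c' = (i',j')`:
`det(u_i,u_{i'}) + det(v_j,v_{j'}) + (α_i − α_{i'})·ν_{j'} + (μ_j − μ_{j'})·β_i`. [folklore] -/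
def tau (c c' : Fin 3 × Fin 3) : ZMod p :=
  (D.α c.1 * D.β c'.1 - D.β c.1 * D.α c'.1) + (D.μ c.2 * D.ν c'.2 - D.ν c.2 * D.μ c'.2)
    + (D.α c.1 - D.α c'.1) * D.ν c'.2 + (D.μ c.2 - D.μ c'.2) * D.β c.1

/-- The height correction of column `c` over second coordinate `x₂`. [folklore] -/
def corr (c : Fin 3 × Fin 3) (x₂ : ZMod p) : ZMod p :=
  (D.α c.1 + D.μ c.2) * (x₂ + D.β c.1 + D.ν c.2) - D.α c.1 * D.β c.1 - D.μ c.2 * D.ν c.2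

/-- The cell of column `c = (i,j)` over `(x₁, x₂)` at height `h`: `(⟨x₁, x₂, h − corr⟩, y_i, w_j)`. [folklore] -/
def cell (c : Fin 3 × Fin 3) (x₁ x₂ h : ZMod p) : Heis p × Heis p × Heis p :=
  (⟨x₁, x₂, h - D.corr c x₂⟩, D.yEl c.1, D.wEl c.2)

/-- **Key identity.** Two cells interact only if their `(a,b)`-invariants agree and their heights differ by `tau`. [folklore] -/
theorem cellWord_cell {c c' : Fin 3 × Fin 3} {x₁ x₂ h x₁' x₂' h' : ZMod p}
    (hw : cellWord (D.cell c x₁ x₂ h) (D.cell c' x₁' x₂' h') = 1) :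
    x₁' = x₁ + D.α c.1 + D.μ c.2 - D.α c'.1 - D.μ c'.2 ∧
      x₂' = x₂ + D.β c.1 + D.ν c.2 - D.β c'.1 - D.ν c'.2 ∧ h - h' = D.tau c c' := by
  simp only [cellWord, cell, yEl, wEl, Heis.mul_def, Heis.inv_def, Heis.one_def, Heis.mk.injEq] at hw
  obtain ⟨h1, h2, h3⟩ := hw
  have e1 : x₁' = x₁ + D.α c.1 + D.μ c.2 - D.α c'.1 - D.μ c'.2 := by linear_combination -h1
  have e2 : x₂' = x₂ + D.β c.1 + D.ν c.2 - D.β c'.1 - D.ν c'.2 := by linear_combination -h2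
  refine ⟨e1, e2, ?_⟩
  subst e1 e2
  simp only [corr] at h3
  simp only [tau]
  linear_combination h3

/-- The injectivity data of a nondegenerate planar box: `yEl` and `wEl` are injective. [folklore] -/
structure Nondeg : Prop where
  /-- the three `Y`-elements are distinct -/
  y_inj : Function.Injective D.yEl
  /-- the three `W`-elements are distinct -/
  w_inj : Function.Injective D.wEl

/-- Cells determine their data (for a nondegenerate box). [folklore] -/
theorem cell_inj (hD : D.Nondeg) {c c' : Fin 3 × Fin 3} {x₁ x₂ h x₁' x₂' h' : ZMod p}
    (e : D.cell c x₁ x₂ h = D.cell c' x₁' x₂' h') : c = c' ∧ x₁ = x₁' ∧ x₂ = x₂' ∧ h = h' := by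
  simp only [cell, Prod.mk.injEq, Heis.mk.injEq] at e
  obtain ⟨⟨e1, e2, e3⟩, ey, ew⟩ := e
  have hc1 : c.1 = c'.1 := hD.y_inj ey
  have hc2 : c.2 = c'.2 := hD.w_inj ew
  have hc : c = c' := Prod.ext hc1 hc2
  subst hc
  refine ⟨rfl, e1, e2, ?_⟩
  subst e1 e2
  linear_combination e3

/-- A pattern `T ⊆ (Fin 3 × Fin 3) × ZMod p` (column, height) is *independent* when no ordered pair of distinct entries sits at
a forbidden height difference. [folklore] -/
def PatIndep (T : Finset ((Fin 3 × Fin 3) × ZMod p)) : Prop :=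
  ∀ a ∈ T, ∀ b ∈ T, a ≠ b → a.2 - b.2 ≠ D.tau a.1 b.1

/-- Pattern independence is decidable (finite quantifiers over `T`, equality in `ZMod p`). [folklore] -/
instance (T : Finset ((Fin 3 × Fin 3) × ZMod p)) [NeZero p] : Decidable (D.PatIndep T) := by
  unfold PatIndep; infer_instance

variable [NeZero p]

/-- The cell set of a pattern: over every entry `(c, h)` all `p²` cells of column `c` at height `h`. [folklore] -/
def cellSet (T : Finset ((Fin 3 × Fin 3) × ZMod p)) : Finset (Heis p × Heis p × Heis p) :=
  T.biUnion fun a => (univ : Finset (ZMod p × ZMod p)).image fun x => D.cell a.1 x.1 x.2 a.2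

/-- Membership in the cell set. [folklore] -/
theorem mem_cellSet {T : Finset ((Fin 3 × Fin 3) × ZMod p)} {P : Heis p × Heis p × Heis p} :
    P ∈ D.cellSet T ↔ ∃ a ∈ T, ∃ x₁ x₂ : ZMod p, P = D.cell a.1 x₁ x₂ a.2 := by
  constructor
  · intro hP
    obtain ⟨a, ha, hP⟩ := mem_biUnion.1 hP
    obtain ⟨x, -, hx⟩ := mem_image.1 hP
    exact ⟨a, ha, x.1, x.2, hx.symm⟩
  · rintro ⟨a, ha, x₁, x₂, rfl⟩
    exact mem_biUnion.2 ⟨a, ha, mem_image.2 ⟨(x₁, x₂), mem_univ _, rfl⟩⟩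

/-- The cell set lies in the box `Heis p × Y × W`, `Y = {y_i}`, `W = {w_j}`. [folklore] -/
theorem cellSet_subset (T : Finset ((Fin 3 × Fin 3) × ZMod p)) :
    D.cellSet T ⊆ univ ×ˢ ((univ.image D.yEl) ×ˢ (univ.image D.wEl)) := by
  intro P hP
  obtain ⟨a, -, x₁, x₂, rfl⟩ := (D.mem_cellSet).1 hP
  simp only [cell, mem_product, mem_univ, true_and, mem_image]
  exact ⟨⟨a.1.1, rfl⟩, ⟨a.1.2, rfl⟩⟩

/-- The cell set has `#T · p²` cells (nondegenerate box). [folklore] -/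
theorem card_cellSet (hD : D.Nondeg) (T : Finset ((Fin 3 × Fin 3) × ZMod p)) :
    #(D.cellSet T) = #T * (p * p) := by
  have hinj : ∀ a : (Fin 3 × Fin 3) × ZMod p,
      Function.Injective (fun x : ZMod p × ZMod p => D.cell a.1 x.1 x.2 a.2) := by
    rintro a ⟨x₁, x₂⟩ ⟨x₁', x₂'⟩ e
    obtain ⟨-, e1, e2, -⟩ := D.cell_inj hD e
    simp only at e1 e2
    rw [e1, e2]
  rw [cellSet, card_biUnion]
  · have : ∀ a ∈ T, #((univ : Finset (ZMod p × ZMod p)).image fun x => D.cell a.1 x.1 x.2 a.2) = p * p := fun a _ => by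
      rw [card_image_of_injective _ (hinj a), card_univ, Fintype.card_prod, ZMod.card]
    rw [sum_congr rfl this, sum_const, smul_eq_mul]
  · intro a _ b _ hab
    rw [Function.onFun, disjoint_left]
    intro P hPa hPb
    obtain ⟨x, -, rfl⟩ := mem_image.1 hPa
    obtain ⟨x', -, e⟩ := mem_image.1 hPb
    obtain ⟨hc, -, -, hh⟩ := D.cell_inj hD e.symm
    exact hab (Prod.ext hc hh)

/-- An independent pattern gives an independent cell set. [folklore] -/
theorem cellSet_indep {T : Finset ((Fin 3 × Fin 3) × ZMod p)} (hT : D.PatIndep T) :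
    ∀ P ∈ D.cellSet T, ∀ P' ∈ D.cellSet T, P ≠ P' → cellWord P P' ≠ 1 := by
  intro P hP P' hP' hne hw
  obtain ⟨a, ha, x₁, x₂, rfl⟩ := (D.mem_cellSet).1 hP
  obtain ⟨b, hb, x₁', x₂', rfl⟩ := (D.mem_cellSet).1 hP'
  obtain ⟨e1, e2, e3⟩ := D.cellWord_cell hw
  by_cases hab : a = b
  · subst hab
    apply hne
    have h1 : x₁' = x₁ := by rw [e1]; ring
    have h2 : x₂' = x₂ := by rw [e2]; ring
    rw [h1, h2]
  · exact hT a ha b hb hab e3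

/-- **Witness form of the pattern lemma**: an independent pattern `T` for a nondegenerate planar box gives a `3 × 3` box of
`Heis p` with an independent cell set of exactly `#T · p²` cells. [folklore] -/
theorem exists_indep_of_pattern (hD : D.Nondeg) {T : Finset ((Fin 3 × Fin 3) × ZMod p)} (hT : D.PatIndep T) :
    ∃ (Y W : Finset (Heis p)) (I : Finset (Heis p × Heis p × Heis p)),
      #Y = 3 ∧ #W = 3 ∧ I ⊆ univ ×ˢ (Y ×ˢ W) ∧ (∀ P ∈ I, ∀ P' ∈ I, P ≠ P' → cellWord P P' ≠ 1) ∧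
        #I = #T * (p * p) :=
  ⟨univ.image D.yEl, univ.image D.wEl, D.cellSet T,
    by rw [card_image_of_injective _ hD.y_inj, card_univ, Fintype.card_fin],
    by rw [card_image_of_injective _ hD.w_inj, card_univ, Fintype.card_fin],
    D.cellSet_subset T, D.cellSet_indep hT, D.card_cellSet hD T⟩

/-- **The pattern lemma**: an independent pattern with `9p ≤ 5·#T` makes `Heis p` not box-useful. [folklore] -/
theorem not_boxUseful_of_pattern (hD : D.Nondeg) {T : Finset ((Fin 3 × Fin 3) × ZMod p)} (hT : D.PatIndep T)
    (hbig : 9 * p ≤ 5 * #T) : ¬ BoxUseful (Heis p) := by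
  obtain ⟨Y, W, I, hY, hW, hI, hind, hcard⟩ := D.exists_indep_of_pattern hD hT
  refine not_boxUseful_of_indep hY hW hI hind ?_
  rw [hcard, Heis.card]
  calc 9 * (p * (p * p)) = (9 * p) * (p * p) := by ring
    _ ≤ (5 * #T) * (p * p) := Nat.mul_le_mul_right _ hbig
    _ = 5 * (#T * (p * p)) := by ring

/-- Along a surjection `G ↠ Heis p`, an independent pattern with `9p ≤ 5·#T` makes `G` not box-useful. [folklore] -/
theorem not_boxUseful_of_surjective_of_pattern (hD : D.Nondeg) {T : Finset ((Fin 3 × Fin 3) × ZMod p)}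
    (hT : D.PatIndep T) (hbig : 9 * p ≤ 5 * #T) {G : Type*} [Group G] [Fintype G] [DecidableEq G]
    (f : G →* Heis p) (hf : Function.Surjective f) : ¬ BoxUseful G := by
  obtain ⟨Y, W, I, hY, hW, hI, hind, hcard⟩ := D.exists_indep_of_pattern hD hT
  refine not_boxUseful_of_surjective f hf hY hW hI hind ?_
  rw [hcard, Heis.card]
  calc 9 * (p * (p * p)) = (9 * p) * (p * p) := by ring
    _ ≤ (5 * #T) * (p * p) := Nat.mul_le_mul_right _ hbig
    _ = 5 * (#T * (p * p)) := by ring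

/-- Along an injection `Heis p ↪ G`, an independent pattern with `9p ≤ 5·#T` makes `G` not box-useful. [folklore] -/
theorem not_boxUseful_of_injective_of_pattern (hD : D.Nondeg) {T : Finset ((Fin 3 × Fin 3) × ZMod p)}
    (hT : D.PatIndep T) (hbig : 9 * p ≤ 5 * #T) {G : Type*} [Group G] [Fintype G] [DecidableEq G]
    (f : Heis p →* G) (hf : Function.Injective f) : ¬ BoxUseful G := by
  obtain ⟨Y, W, I, hY, hW, hI, hind, hcard⟩ := D.exists_indep_of_pattern hD hT
  refine not_boxUseful_of_injective f hf hY hW hI hind ?_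
  rw [hcard, Heis.card]
  calc 9 * (p * (p * p)) = (9 * p) * (p * p) := by ring
    _ ≤ (5 * #T) * (p * p) := Nat.mul_le_mul_right _ hbig
    _ = 5 * (#T * (p * p)) := by ring

end PlanarBox

end Heis

end Summit.MatrixMultiplication.OmegaCensus
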